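import Summits.BirchSwinnertonDyer.BirchSwinnertonDyer.Theorems.ByReductionTypeAtTwoRankOneAtTwoOffBigImageOddLocalEngineEndToEnd
import HarnessLib

/-!
# Route `ByReductionTypeAtTwo`, crux `RankOneAtTwoOffBigImageOddLocal` (stmt-BirchSwinnertonDyer-23716), line
# `refined_kolyvagin_tamagawa_shift_at_two` — ENGINE PORT `c₀ ↦ h₀` (regular element), §M the regular primes in the STUB VOCABULARY (`Zhang2014.IsKolyvaginPrime`, `levelIndex`)

Lead prover `prover-cruxlead-stmt-BirchSwinnertonDyer-23716-g0` (2026-08-28), landing the crux-plan g6 ENGINE QUARRY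
`Cruxes/RankOneAtTwoOffBigImageOddLocal/RefinedKolyvaginEngineG6.lean` (planner `cruxplan-…-23716-refined-kolyvag-9ff2fe475f-g6`, v10, ≈2800 lines,
rc 0 / 0 sorry; `Cruxes/` files are not importable, so the lead COPIES the proofs into `Theorems/` — card «LEAD QUICKSTART (g6)» Q2 #3 / Q4) as
`--supports stmt-BirchSwinnertonDyer-23716` helpers, continuing `…Engine{Dictionary,Parity,Cyclotomic,CyclotomicBasis,GoursatLift,Chebotarev,RegularSupply,
RegularLift}.lean`.  The engine port = kernel-closable item #3 of the pen's order (PEN-PICK-23716 ADD-4): Kolyvagin primes whose Frobenius is a REGULAR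
element `h₀` (det `−1`, trace `0`, odd mod `2`; LOSSLESS local Kummer maps by R1/LKL) instead of complex conjugation `c₀` (which loses the top bit at
`Δ > 0`, residual 24883), with McCallum's exact local orders — the supply the line's filtered stubs `…WithOn Φ_reg Ω` consume (card #7
`regular-frobenius-kolyvagin-primes-pos-disc`).  THIS FILE: §M (quarry v11) — `zhang_isKolyvaginPrime_two_of_regular` (a regular Kolyvagin prime of level `2^{n+1}` from §K IS a `Zhang2014.IsKolyvaginPrime (W.conductorNorm ℤ) W K 2 ℓ` with `M(ℓ) ≥ n + 1`: Zhang's notion carries no Frobenius-class condition), `le_levelIndex_two_of_forall`, and `exists_regular_zhangKolyvaginPrimes_of_heegner` (per bound `b`, the shape of the landed §K) — §K end-to-end supply restated in EXACTLY the vocabulary of the registered stubs S3′/S4′/S5′ (`Zhang2014.IsKolyvaginPrime`, `Zhang2014.levelIndex W 2 n`), so the filtered cell stubs `…WithOn RegularAtTwo Ω` can quantify over these primes by name.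

Statements and proofs are the quarry's VERBATIM (namespace moved to `…Theorems.OffBigImageOddLocalAtTwo.Engine`).  Nothing here proves the crux,
`BSDp W 2`, BSD or the summit; no registered stub is discharged (engine inputs only).  BSD is not proved.

Refs: [GrossLMS1991] §3 (3.1)–(3.3), §9; [McCallumLMS1991] §3 (Cor. 3.2, Prop. 3.1), §5; [SilvermanAEC2009] III.7–III.8, VII–VIII; Serre (1972) §5.3.
-/

set_option linter.dupNamespace false -- tree convention: `Summit.BirchSwinnertonDyer.BirchSwinnertonDyer.Theorems` (summit = sub-problem)
set_option autoImplicit false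

noncomputable section

namespace Summit.BirchSwinnertonDyer.BirchSwinnertonDyer.Theorems.OffBigImageOddLocalAtTwo.Engine

/-! ## §M  The regular primes in the STUB VOCABULARY: `Zhang2014.IsKolyvaginPrime N W K 2 ℓ` with `M(ℓ) ≥ n + 1`
(`Zhang2014.levelIndex`) — Zhang's notion has no Frobenius-class condition, so §K's primes qualify verbatim. -/

section StubVocabularyM

open WeierstrassCurve NumberField IsDedekindDomain Field
open Literature.NumberTheory.GaloisRepresentations Literature.NumberTheory.EllipticCurves Literature.NumberTheory
open Summit.BirchSwinnertonDyer.BirchSwinnertonDyer.Theorems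

universe u

variable {W : WeierstrassCurve ℚ} {K : Type u} [Field K] [NumberField K]

/-- **A regular Kolyvagin prime of level `2^{n+1}` is a Zhang-Kolyvagin prime at `p = 2` with `M(ℓ) ≥ n + 1`** — the vocabulary
of the big-image stubs S3/S4/S5 (`Zhang2014.IsKolyvaginPrime (W.conductorNorm ℤ) W K 2 ℓ`, `Zhang2014.levelIndex W 2 n`): Zhang's notion
carries NO Frobenius-class condition (unlike Gross's (3.2) `FrobEqFrobInfty`), only `ℓ ∤ N d_K`, `ℓ ≠ 2`, `(ℓ)` inert and `M(ℓ) > 0`, all of which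
§K delivers. [cite: WZhang2014, Notations (xii)] -/
theorem zhang_isKolyvaginPrime_two_of_regular [W.IsGloballyMinimal] {N ℓ n : ℕ} (hℓ : ℓ.Prime) (hN : ¬ ℓ ∣ N)
    (hd : ¬ ((ℓ : ℤ) ∣ NumberField.discr K)) (h2 : ℓ ≠ 2) (hP : (Ideal.span {(ℓ : 𝓞 K)}).IsPrime)
    (h1 : 2 ^ (n + 1) ∣ ℓ + 1) (ha : ((2 : ℤ) ^ (n + 1)) ∣ W.frobeniusTrace ℓ) :
    Zhang2014.IsKolyvaginPrime N W K 2 ℓ ∧ n + 1 ≤ Zhang2014.kolyvaginIndex W 2 ℓ ∧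
      ((n + 1 : ℕ) : ℕ∞) ≤ Zhang2014.levelIndex W 2 ℓ := by
  haveI : Fact (Nat.Prime 2) := ⟨Nat.prime_two⟩
  have hM : n + 1 ≤ Zhang2014.kolyvaginIndex W 2 ℓ :=
    Zhang2014.le_kolyvaginIndex_iff.mpr ⟨h1, by exact_mod_cast ha⟩
  refine ⟨⟨hℓ, hN, hd, h2, hP, by omega⟩, hM, ?_⟩
  rw [Zhang2014.natCast_le_levelIndex_iff]
  intro q hq
  rw [hℓ.primeFactors, Finset.mem_singleton] at hq
  subst hq
  exact hM

/-- Square-free products: if every prime factor of `m` is a regular Kolyvagin prime of level `2^{n+1}` then `M(m) ≥ n + 1`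
(`Zhang2014.levelIndex`). [cite: WZhang2014, Notations (xii)] -/
theorem le_levelIndex_two_of_forall [W.IsGloballyMinimal] {m n : ℕ}
    (h : ∀ ℓ ∈ m.primeFactors, 2 ^ (n + 1) ∣ ℓ + 1 ∧ ((2 : ℤ) ^ (n + 1)) ∣ W.frobeniusTrace ℓ) :
    ((n + 1 : ℕ) : ℕ∞) ≤ Zhang2014.levelIndex W 2 m := by
  haveI : Fact (Nat.Prime 2) := ⟨Nat.prime_two⟩
  rw [Zhang2014.natCast_le_levelIndex_iff]
  intro ℓ hℓ
  obtain ⟨h1, ha⟩ := h ℓ hℓ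
  exact Zhang2014.le_kolyvaginIndex_iff.mpr ⟨h1, by exact_mod_cast ha⟩

/-- **THE ENGINE PORT IN THE BIG-IMAGE STUBS' OWN WORDS** (S3/S4/S5: `Zhang2014.IsKolyvaginPrime (W.conductorNorm ℤ) W K 2 ℓ`,
`levelIndex`): under the stub binders (`IsImaginaryQuadratic K`, `Odd d_K`, `SatisfiesHeegnerHypothesis N_E K`, `ρ̄_{E,2}` and `ρ̄_{E,2^{n+1}}` onto), a complex
conjugation `c₀`, `c ≠ 1`, τ-stable class data and Čebotarev: ONE `ρ ∈ Γ_K` with `h = c₀ · res ρ` a lossless `μ`-inverting involution on `E[2^{n+1}]`, and beyond every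
bound a prime `ℓ` which is a ZHANG–KOLYVAGIN PRIME AT `2` of level index `≥ n + 1`, whose Frobenius is `h` on `E[2^{n+1}]` and `c₀` on `K`, with the prescribed EXACT
local orders of the classes at `λ ∣ ℓ`.  (Take `N := W.conductorNorm ℤ`.) [cite: WZhang2014, Notations (xii)] [cite: GrossLMS1991, §3, §9] -/
theorem exists_regular_zhangKolyvaginPrimes_of_heegner (hCheb : Automorphic.chebotarev_artinRep) {N : ℕ}
    [NeZero N] [W.IsElliptic] [W.IsGloballyMinimal] (hK : IsImaginaryQuadratic K)
    (hodd : Odd (NumberField.discr K)) (hH : SatisfiesHeegnerHypothesis (W.conductorNorm ℤ) K) (n : ℕ)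
    (hρ2 : W.HasSurjectiveModNGaloisRep 2) (hsurj : W.HasSurjectiveModNGaloisRep ((2 ^ (n + 1) : ℕ) : ℤ))
    {c₀ : absoluteGaloisGroup ℚ} (hc₀ : IsComplexConjugation (Rat.castHom ℝ) c₀)
    {c : K ≃ₐ[ℚ] K} (hc : c ≠ 1)
    {r : ℕ} (cs : Fin r → galH1Torsion (W.baseChange K) ((2 ^ (n + 1) : ℕ) : ℤ)) {π : Fin r → Fin r}
    (hπ : ∀ i, π (π i) = i) (hcs : ∀ i, conjAct W c ((2 ^ (n + 1) : ℕ) : ℤ) (cs i) = cs (π i))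
    (e : Fin r → ℕ) (he : ∀ i, ((2 : ℤ) ^ e i) • cs i = 0)
    (hind : ∀ a : Fin r → ℤ, ∑ i, a i • cs i = 0 → ∀ i, ((2 : ℤ) ^ e i) ∣ a i)
    (hres : ∀ a : Fin r → ℤ, (∀ ρ ∈ torsionFixing (W.baseChange K) ((2 ^ (n + 1) : ℕ) : ℤ),
      h1Eval (W.baseChange K) ((2 ^ (n + 1) : ℕ) : ℤ) (∑ i, a i • cs i) ρ = 0) → ∑ i, a i • cs i = 0)
    (Nv : Fin r → ℕ) (hNe : ∀ i, Nv i ≤ e i) (heM : ∀ i, e i ≤ n + 1) (hNπ : ∀ i, Nv (π i) = Nv i)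
    (b : ℕ) :
    ∃ ρ : absoluteGaloisGroup K,
      (∀ X : geomTorsion W ((2 ^ (n + 1) : ℕ) : ℤ),
        (c₀ * absGaloisRestrict ℚ K ρ) • (c₀ * absGaloisRestrict ℚ K ρ) • X = X) ∧
      (∀ ζ : AlgebraicClosure ℚ, ζ ^ (2 ^ (n + 1)) = 1 → (c₀ * absGaloisRestrict ℚ K ρ) • ζ = ζ⁻¹) ∧
      (∃ P : geomTorsion W ((2 ^ (n + 1) : ℕ) : ℤ),
        (2 : ℤ) ^ n • (P + (c₀ * absGaloisRestrict ℚ K ρ) • P) ≠ 0) ∧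
      (∀ (k : ℕ) (X : geomTorsion W ((2 ^ (n + 1) : ℕ) : ℤ)), (2 : ℤ) ^ k • X = 0 →
          (c₀ * absGaloisRestrict ℚ K ρ) • X = X →
          ∃ Y : geomTorsion W ((2 ^ (n + 1) : ℕ) : ℤ),
            (2 : ℤ) ^ k • Y = 0 ∧ X = Y + (c₀ * absGaloisRestrict ℚ K ρ) • Y) ∧
      ∃ ℓ : ℕ, b < ℓ ∧ Zhang2014.IsKolyvaginPrime N W K 2 ℓ ∧
        ((n + 1 : ℕ) : ℕ∞) ≤ Zhang2014.levelIndex W 2 ℓ ∧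
        (∃ (v : HeightOneSpectrum (𝓞 ℚ)) (𝔓 : Ideal (absIntegers (𝓞 ℚ) ℚ)) (h : absoluteGaloisGroup ℚ),
          (ℓ : 𝓞 ℚ) ∈ v.asIdeal ∧ 𝔓 ∈ v.primesAbove ∧ IsArithFrobAt (𝓞 ℚ) h 𝔓 ∧
          (∀ P : geomTorsion W ((2 ^ (n + 1) : ℕ) : ℤ), h • P = (c₀ * absGaloisRestrict ℚ K ρ) • P) ∧
          ∀ (e : K →ₐ[ℚ] AlgebraicClosure ℚ) (x : K), h • e x = c₀ • e x) ∧
        ∀ i, ∀ v : HeightOneSpectrum (𝓞 K), (ℓ : 𝓞 K) ∈ v.asIdeal →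
          (((2 : ℤ) ^ Nv i) • cs i ∈
              (W.baseChange K).torsionLocalKer (v.adicCompletion K) ((2 ^ (n + 1) : ℕ) : ℤ) ∧
            (Nv i ≠ 0 → ((2 : ℤ) ^ (Nv i - 1)) • cs i ∉
              (W.baseChange K).torsionLocalKer (v.adicCompletion K) ((2 ^ (n + 1) : ℕ) : ℤ))) := by
  obtain ⟨ρ, h1, h2, h3, h4, ℓ, hb, hℓp, hℓN, hℓd, hℓ2, hℓP, hfrob, hℓ1, hℓa, hloc⟩ :=
    exists_regular_kolyvaginPrime_of_heegner (N := N) hCheb hK hodd hH n hρ2 hsurj hc₀ hc cs hπ hcs e he hind hres Nv hNe heM hNπ b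
  obtain ⟨hZ, -, hlev⟩ := zhang_isKolyvaginPrime_two_of_regular (W := W) (K := K) (N := N) hℓp hℓN hℓd hℓ2 hℓP hℓ1 hℓa
  exact ⟨ρ, h1, h2, h3, h4, ℓ, hb, hZ, hlev, hfrob, hloc⟩

end StubVocabularyM

end Summit.BirchSwinnertonDyer.BirchSwinnertonDyer.Theorems.OffBigImageOddLocalAtTwo.Engine

end
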